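import Literature.MathematicalPhysics.QuantumFieldTheory.Balaban1983to89.B6Geom246MultiLevelBox
import Literature.MathematicalPhysics.QuantumFieldTheory.Balaban1983to89.B6Prop22AllTwoLevelBox
import Literature.MathematicalPhysics.QuantumFieldTheory.Balaban1983to89.B6

/-!
# `Balaban1983to89.B6Prop22TwoLevelCensus` — [B6] Proposition 2.2 (2.67) IN ITS CENSUS TYPING (`B6.Prop22Printed`: the
# four sup entries |G′λ|, |∇G′λ|, |G′∇*λ|, |ΔG′λ| AS ITS FIRST CONJUNCT, the two `ζ`-dressed Hölder entries FOR EACH `α`,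
# with the printed prefactors, the REALISED multiscale distance (2.46) and «M sufficiently large») FOR THE GENUINE
# TWO-LEVEL OPERATOR `G′ = (Δ^{ξ,N}_X + Q′*aQ′)⁻¹` OF THE p21 LINEAGE ON THE TWO-LEVEL MEMBERS OF THE NESTED FAMILIES
# (2.1)–(2.2), WITH NON-VACUITY (v1.1; nothing existing outside this file is touched; no fact is minted; every input is a
# kernel-proved theorem consumed BY NAME)

FRAMING (verbatim cell line):
statement-level skeleton of published theorems with citation tags; proofs where landed; nothing here is a claim about the Yang–Mills mass gap

Source under audit (cell pub-balaban): T. Bałaban, *Propagators and renormalization transformations for lattice gauge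
theories. II*, Commun. Math. Phys. **96** (1984) 223–250 [`Balaban1984PropagatorsII`, "B6"]: p. 234 [PDF 12]
Proposition 2.2 (2.67); p. 224 [PDF 2] (2.1)–(2.4) (the nested sequence of domains, the big blocks, the layers `Λ_j`);
p. 225 [PDF 3] (2.13)–(2.14) (the weights `a_j`); p. 230 [PDF 8] (2.40)–(2.42) (the `L^{−j}`-scale and the two-level
operator); p. 231 [PDF 9] (2.45)–(2.46) (the set of blocks `𝔅` and the multiscale distance `d(y,y′)`); p. 232 [PDF 10]
(2.53) and the sentence before it (reading the `L^{−j}`-lattice decay in the scaled distance).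

## WHAT IS PRINTED (p. 234, verbatim up to notation)

«Proposition 2.2. If we have (2.1), (2.2) and M is sufficiently large, then the operator G′ = Δ′_a^{−1} (a = 1) satisfies
the inequalities
|(G′λ)(x)|, |(∇G′λ)(x)|, |(G′∇*λ)(x)|, ‖ζ∇G′λ‖_α, ‖ζG′∇*λ‖_α, |(ΔG′λ)(x)|
 ≤ O(1)[(L^jη)², L^jη, L^jη, (L^jη)^{1−α}(‖ζ‖_α + |ζ|), (L^jη)^{1−α}(‖ζ‖_α + |ζ|), 1]e^{−½δ₀d(y,y′)}|λ|   (2.67)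
for x ∈ B^j(y), or ζ with supp ζ ⊂ B^j(y), y ∈ Λ_j, and for λ with supp λ ⊂ B^{j′}(y′). The random walk representation
(2.50) is convergent in the norms defined by these inequalities.»
The census file `B6` types this sentence as `B6.Prop22Printed geo Gp` over an index family of `B6.Geometry`s (sites =
the blocks `𝔅` of (2.45) with their levels, `dist` = (2.46), `len y = L^{scale y}·η`, hypothesis slot `Hyp21_22`, size `M`)
with functionals `Gp : B6.GpFamily` (the four sup entries `e 0…3` and the Hölder slot `h1`):
`∃ M₁ δ₀ C, ∃ Cα, 0 < M₁ ∧ 0 < δ₀ ∧ 0 < C ∧ ∀ i, Hyp21_22 → M₁ ≤ M → (sup conjunct) ∧ (Hölder conjunct)`.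

## WHAT THIS FILE CERTIFIES (kernel-checked; `A = 0`; the p21 two-level lineage and the p21 geometry (2.46) are USED)

* §1–§2 `TLIdx d ℓ` — THE INDEX FAMILY OF THE TWO-LEVEL MEMBERS of (2.1)–(2.2): mesh exponent `k ≥ 1`, big-block parameter
  `M_h ≥ 1` (`M = L·M_h`), separation integer `R`, volume `P`, and the set `Λb` of big `(k+1)`-block labels; the member
  `TLIdx.dom : B6MultiLevelBoxOperator.Domains d ℓ M_h (k+1) P R` has `Ω₁ = … = Ω_k = X` (the fine box) and
  `Ω_{k+1} = B^{k+1}(Λ_{k+1})` = the big blocks of `Λb` ((2.1) by construction, (2.2) void).  Its operator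
  `TLIdx.G = gTwoLevel n ℓ (aPrinted ℓ 1 k) 1 0 M′ Λ` is THE GENUINE TWO-LEVEL OPERATOR `(Δ^{ξ,N}_X + Q′*aQ′)⁻¹` of
  `B6Ineq243TwoLevelBox` (two-sided inverse: `twoLevelOp_mul_gTwoLevel`) with the PRINTED weights `a_k = B1.aSeq 1 L k`,
  `a_{k+1} = aa_k/(aL^{−2} + a_k)`, `a = 1` («(a = 1)»), `m² = 0`, where `Λ` = the level-`k` block labels inside the big
  blocks of `Λb` — and `lev_eq_succ_iff` certifies that THIS `Λ` is exactly the region where the member's level is `k + 1`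
  (the operator and the geometry speak about the same `Ω_{k+1}`).
* §3 `TLIdx.geo : B6.Geometry` — THE CENSUS GEOMETRY OF THE MEMBER = p21's realised geometry `B6Geom246MultiLevelBox.geom dom`
  (sites `bset dom` = the blocks of (2.45) of both levels, `scale` = level, `dist` = the graph distance of touching blocks,
  which `Realizes` the printed (2.46): `B6Geom246MultiLevelBox.realizes`) with `η := L^{−k}` (the `L^{−j}`-scale of (2.40):
  level-`k` blocks are unit cubes, level-`(k+1)` blocks have side `L`, so `L^jη ∈ {1, L}`, `one_le_len`), `M := L·M_h`,
  `Hyp21_22 := True` (honest: (2.1) and (2.2) are the FIELDS `bigBlocks`/`sep` of the structure `Domains` the member is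
  built from, not hypotheses to be assumed), arguments `λ` and cut-offs `ζ` = real lattice functions on the fine box,
  `suppIn λ y′` ⇔ `supp λ ⊂ B(y′)`, `|λ| = sup|λ(x)|` (`supF`), `‖·‖_α` = the lattice Hölder seminorm on the `ξ`-lattice (`hq`).
* §4 `TLIdx.gp : B6.GpFamily geo` — THE (2.67) FUNCTIONALS OF `G′`: `e 0 λ y = sup_{x ∈ B(y)}|(G′λ)(x)|`,
  `e 1 λ y = sup_{x ∈ B(y), μ}|ξ^{−1}((G′λ)(x + e_μ) − (G′λ)(x))|`, `e 2 λ y = sup_{x ∈ B(y), μ}|(G′∇^{ξ*}_μλ)(x)|`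
  (`dstar`, the kernel of entry 3 of the lineage), `e 3 λ y = sup_{x ∈ B(y)}|(ξ^{−2}Δ^N_XG′λ)(x)|` (`lapOp`), and the
  `ζ`-dressed Hölder slot `h1 λ α ζ = max_μ max(‖ζ∇^ξ_μG′λ‖_α, ‖ζG′∇^{ξ*}_μλ‖_α)` (`hH`: the bond function `ζ∇^ξ_μG′λ` over
  pairs of `μ`-bonds of the box `hqB`, the site function `ζG′∇^{ξ*}_μλ` over pairs of sites `hq`; v1 read the first over site
  pairs with the face convention `∇_μ := 0` where the box has no `μ`-bond — a stronger functional than the lineage's bond-pair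
  theorems speak about; no theorem of v1 mentioned `hH`); and the conversion lemma **`abs_sum_mul_le`** KERNEL FORM ⇒ CENSUS
  FORM: for `supp λ ⊂ B(y′)`,
  `|Σ_z g(z)λ(z)| ≤ e^{δ}e^{−(δ/(d+1))d(y(x),y′)}·(Σ_z|g(z)|e^{δ|x−z|_∞/n})·|λ|`, from p21's comparison
  `dist_blkOf_le_box` of the realised distance (2.46) with the scaled sup-distance (p. 232: every site of the member has
  level `≥ k`, so `d(y(x), y(z)) ≤ (d+1)(|x − z|_∞/L^k + 1)`, `dist_blkD_le`).
* §5 **`prop22_supEntries_twoLevel`** — PROPOSITION 2.2 (2.67), ENTRIES 1, 2, 3, 6, IN THE CENSUS TYPING, ON THE WHOLE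
  TWO-LEVEL FAMILY: LITERALLY THE FIRST CONJUNCT of `B6.Prop22Printed (fun i : TLIdx d ℓ => i.geo) (fun i => i.gp)`:
  `∃ M₁ δ₀ C > 0` (functions of `d`, `L`) `∀ i, Hyp21_22 → M₁ ≤ M → ∀ m λ y y′, suppIn λ y′ →
  e m λ y ≤ C·pref4 (len y) m·e^{−½δ₀·dist y y′}·|λ|` — for EVERY mesh `k ≥ 1`, every `M_h` with `L·M_h ≥ M₁` («M
  sufficiently large»), every volume, every `Λb`.  Proof = the printed architecture as certified by the lineage: p21's
  package `B6Prop22AllTwoLevelBox.prop22_six_twoLevelBox` (all six entries of (2.67) in weighted-row form with common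
  constants, uniformly in the mesh, along the window `a_k ∈ [1 − L^{−2}, 1]` which contains the printed `B1.aSeq 1 L k`,
  `aPrinted_window`) at `α = 0`, read on the member's operator, then `abs_sum_mul_le`; the prefactors `[(L^jη)², L^jη,
  L^jη, 1] ≥ 1` are honest slack here (`one_le_pref4`; the lineage's bounds are uniform in the level).
* §6 **`twoLevel_nonvacuous`** — for every mesh `k ≥ 1` and every threshold `M₁` a member with `M ≥ M₁` whose geometry has
  blocks at BOTH levels (`TLIdx.twoBlock`: one big `(k+1)`-block of level `k + 1` in a box of `2^{d+1}` big blocks), so §5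
  quantifies over genuinely two-level multiscale geometries (level-dependent `L^jη`, two-level distance (2.46)) beyond every
  threshold — not over a degenerate or empty family.
* §7 (v1.1) **`prop22_holderEntries_twoLevel`** — PROPOSITION 2.2 (2.67), THE HÖLDER ENTRIES 4 AND 5, IN THE CENSUS TYPING,
  FOR EACH `0 ≤ α < 1`: the second conjunct of `B6.Prop22Printed` at a fixed `α` (quantifier order `∀ α ∃ M₁ δ₀ C`):
  `h1 λ α ζ ≤ C·(len y)^{1−α}·cutH α ζ·e^{−½δ₀·dist y y′}·|λ|` for `cutIn ζ y`, `suppIn λ y′`, every member with `M ≥ M₁`.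
  Proof = the printed product rule for `ζ·F` (`holder_pair_bound`: three cases according to which of the two sites lie in
  `B(y) ⊃ supp ζ`) fed with the lineage's package at this `α`: the sup of `F = ∇^ξ_μG′λ`, `G′∇^{ξ*}_μλ` on `B(y)` from entries
  2, 3 (weighted rows, one-centre conversion `abs_sum_mul_le`) and the Hölder quotient of `F` inside `B(y)` from entries 4, 5
  (two-centre weighted rows of [3] (1.9) type, two-centre conversion **`abs_sum_mul_le2`**); `(L^jη)^{1−α} ≥ 1` is slack.

## HONEST SCOPE (what is NOT certified here)

(1) THE TWO CONJUNCTS SEPARATELY, THE SECOND PER `α`: `B6.Prop22Printed` itself (`∃ M₁ δ₀ C, ∃ Cα, … ∀ α`: ONE `δ₀` and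
ONE `M₁` for all `0 ≤ α < 1`) is NOT inhabited: the lineage certifies entries 4, 5 (`prop22_entry4_twoLevelBox`,
`prop22_entry5_twoLevelBox`, inside `prop22_six_twoLevelBox`) in the quantifier order `∀ α ∃ δ(α) M₀(α) C(α)`, and the census
order needs the `α`-uniformity of the rate at the [3]-level root (`B4Thm19ZeroBoxHolder`), which is not packaged in the
tree; it is NOT assumed here either (no hypothesis, no fact) — the conjunction with the census quantifier order on this
family is left to a successor once an `α`-uniform Hölder package lands.
(2) TWO LEVELS (`k`, `k + 1`), i.e. the members of (2.1)–(2.2) with `Ω_j = X` for `j ≤ k`; the general nested sequence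
with `k + 1` distinct levels is p21's `Domains`/`gml` programme (`B6Prop22MultiLevelBox`).  (3) UNITS: the `L^{−k}`-scale
of (2.40) (`η := L^{−k}` in the census geometry; derivatives, Laplacian, Hölder quotients and `|x − z|` on the `ξ = L^{−k}`
lattice, as in the whole lineage); the `η`-lattice form of (2.67) differs by the homogeneity rescaling `x ↦ L^kηx`, not
performed here.  (4) CARRIER: the Neumann box `X = Π_μ[0, P_μ·LM)` of the `L^{−k}`-lattice (`P_μ` big `(k+1)`-blocks per direction) of the
lineage for `Ω₁` (print: domains
in the torus `T_η`; «we admit the case when some domains Ω_j are equal to T_η», p. 224); the forward difference of entries 2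
and 4 is taken along bonds of the box (`fwd`: no bond leaves `X`; the Hölder seminorm of the bond function `ζ∇^ξ_μG′λ`
runs over pairs of `μ`-bonds, `hqB`).  (5) ENTRY 3 is typed PER COMPONENT `μ` (`G′∇^{ξ*}_μλ` for a
scalar `λ` supported in `B(y′)`); the printed `G′∇*λ = Σ_μ G′∇*_μλ_μ` for a bond field follows with the factor `d + 1`.
(6) `m² = 0`, `a = 1`, `A = 0` (no background field — the whole lineage).  (7) Constants are existential (closed terms of
the lineage's constants), not numerically evaluated.

Value = the census sentence (2.67) (sup part verbatim, Hölder part per `α`) on honest multi-level geometries, by reduction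
to kernel-checked theorems; NOT summit progress (the Yang–Mills statements are untouched).
-/
noncomputable section

open scoped BigOperators
open Finset Matrix

namespace Literature.MathematicalPhysics.QuantumFieldTheory.Balaban1983to89.B6Prop22TwoLevelCensus

open Literature.MathematicalPhysics.QuantumFieldTheory.Balaban1983to89.B4ContourShift (supNorm abs_le_supNorm supNorm_nonneg
  exists_supNorm_eq)
open Literature.MathematicalPhysics.QuantumFieldTheory.Balaban1983to89.B4Reflection242 (boxDom mem_boxDom blk blk_mem_boxDom)
open Literature.MathematicalPhysics.QuantumFieldTheory.Balaban1983to89.B4Thm110ZeroBox (blk_blk roww)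
open Literature.MathematicalPhysics.QuantumFieldTheory.Balaban1983to89.B4Thm110ZeroBoxDeriv (wsum)
open Literature.MathematicalPhysics.QuantumFieldTheory.Balaban1983to89.B4Lemma22ZeroBoxDerivDual (fwd)
open Literature.MathematicalPhysics.QuantumFieldTheory.Balaban1983to89.B4Thm19ZeroBoxHolder (wsum2)
open Literature.MathematicalPhysics.QuantumFieldTheory.Balaban1983to89.B6MultiLevelBoxOperator (N0 bigSide Domains aPrinted
  aPrinted_window aPrinted_succ)
open Literature.MathematicalPhysics.QuantumFieldTheory.Balaban1983to89.B6Geom246MultiLevelBox (bset blkOf geom bond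
  exists_blkOf_eq lev_eq_of_blkOf_eq dist_blkOf_le_box scale_bounds)
open Literature.MathematicalPhysics.QuantumFieldTheory.Balaban1983to89.B6Ineq243TwoLevelBox (gTwoLevel IsBlockUnion aNext
  roww_mono wsum_mono)
open Literature.MathematicalPhysics.QuantumFieldTheory.Balaban1983to89.B6Ineq243AdjTwoLevelBox (dstar)
open Literature.MathematicalPhysics.QuantumFieldTheory.Balaban1983to89.B6Prop22LapTwoLevelBox (lapOp)
open Literature.MathematicalPhysics.QuantumFieldTheory.Balaban1983to89.B6Prop22AllTwoLevelBox (prop22_six_twoLevelBox)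
open Literature.MathematicalPhysics.QuantumFieldTheory.Balaban1983to89.B6 (Geometry GpFamily Prop22Printed pref4)

variable {d : ℕ}

/-! ## §1 The two-level members of the nested families (2.1)–(2.2) -/

/-- **INDEX OF THE TWO-LEVEL FAMILY** (`d`, `L = ℓ + 1` fixed): mesh exponent `k ≥ 1` (level-`k` blocks have `L^k` fine
sites per side), big-block parameter `M_h ≥ 1` (`M = L·M_h`), the separation integer `R`, box half-widths `P_μ ≥ 1`
(fine box `X = Π_μ[0, L^{k+1}·L·M_h·P_μ)`), and the set `Λb` of big-`(k+1)`-block labels forming `Ω_{k+1} = B^{k+1}(Λ_{k+1})`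
(`Ω₁ = … = Ω_k = X`, print p. 224 «we admit the case when some domains Ω_j are equal to T_η»).
[cite: Balaban1984PropagatorsII, (2.1)–(2.2) p.224] -/
structure TLIdx (d ℓ : ℕ) where
  k : ℕ
  Mh : ℕ
  R : ℕ
  P : Fin (d + 1) → ℕ
  Λb : Finset (Fin (d + 1) → ℤ)
  hk : 1 ≤ k
  hMh : 1 ≤ Mh
  hP : ∀ μ, 1 ≤ P μ

namespace TLIdx

variable {ℓ : ℕ} (i : TLIdx d ℓ)

/-- the level function of the member: `k + 1` on the big `(k+1)`-blocks of `Λb`, `k` elsewhere. [cite: Balaban1984PropagatorsII, (2.1)–(2.4) p.224] -/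
def lev (x : Fin (d + 1) → ℤ) : ℕ := if blk (bigSide ℓ i.Mh (i.k + 1)) x ∈ i.Λb then i.k + 1 else i.k

/-- every site has level `k` or `k + 1`. [cite: Balaban1984PropagatorsII, (2.1) p.224] -/
theorem lev_eq_or (x : Fin (d + 1) → ℤ) : i.lev x = i.k ∨ i.lev x = i.k + 1 := by
  unfold lev; split_ifs <;> simp

/-- every site has level `≥ k`. [cite: Balaban1984PropagatorsII, (2.1) p.224] -/
theorem k_le_lev (x : Fin (d + 1) → ℤ) : i.k ≤ i.lev x := by
  rcases i.lev_eq_or x with h | h <;> omega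

/-- every site has level `≤ k + 1`. [cite: Balaban1984PropagatorsII, (2.1) p.224] -/
theorem lev_le_succ (x : Fin (d + 1) → ℤ) : i.lev x ≤ i.k + 1 := by
  rcases i.lev_eq_or x with h | h <;> omega

/-- **THE TWO-LEVEL MEMBER AS A NESTED FAMILY (2.1)–(2.2)** of `B6MultiLevelBoxOperator.Domains` (top level `k + 1`):
(2.1) holds because `Ω_{k+1}` is a union of big `(k+1)`-blocks by construction and `Ω_j = X` for `j ≤ k`; (2.2) is void
(`Ω_j^c = ∅` for `j ≤ k`). [cite: Balaban1984PropagatorsII, (2.1)–(2.2) p.224] -/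
def dom : Domains d ℓ i.Mh (i.k + 1) i.P i.R where
  lev := i.lev
  one_le_lev := fun x => le_trans i.hk (i.k_le_lev x)
  lev_le := i.lev_le_succ
  bigBlocks := by
    intro j hj x _ x' _ hb
    by_cases hjk : j ≤ i.k
    · exact ⟨fun _ => le_trans hjk (i.k_le_lev x'), fun _ => le_trans hjk (i.k_le_lev x)⟩
    by_cases hje : j = i.k + 1
    · subst hje
      have key : ∀ y : Fin (d + 1) → ℤ, i.k + 1 ≤ i.lev y ↔ blk (bigSide ℓ i.Mh (i.k + 1)) y ∈ i.Λb := by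
        intro y; unfold lev; split_ifs with h
        · simp [h]
        · simp [h]
      rw [key, key, hb]
    · have h1 := i.lev_le_succ x; have h2 := i.lev_le_succ x'
      constructor <;> intro h <;> omega
  sep := by
    intro j x _ x' _ h1 h2
    have := i.k_le_lev x; have := i.lev_le_succ x'
    exfalso; omega

/-- the member's level function is `lev`. [cite: Balaban1984PropagatorsII, (2.1) p.224, dictionary] -/
@[simp] theorem dom_lev : i.dom.lev = i.lev := rfl

/-! ## §2 The presentation of the two-level lane (`B6Ineq243TwoLevelBox` … `B6Prop22AllTwoLevelBox`) -/

/-- `n = L^k` fine sites per level-`k` block (the mesh factor of the two-level lane; `ξ = 1/n`). [cite: Balaban1984PropagatorsII, (2.40) p.230 («Rescaling … to L^{−j}-scale, i.e. ξ = L^{−j}»)] -/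
abbrev n : ℕ := (ℓ + 1) ^ i.k

/-- the box parameter `M′_μ = M_h·(L·P_μ)` of `gTwoLevel` (unit box `Π[0, L·M′_μ)` of level-`k` block labels). [cite: Balaban1984PropagatorsII, (2.41) p.230, dictionary] -/
abbrev Mp : Fin (d + 1) → ℕ := fun μ => i.Mh * ((ℓ + 1) * i.P μ)

/-- the unit box of level-`k` block labels. [cite: Balaban1984PropagatorsII, (2.41) p.230 («□^{(j)}»), dictionary] -/
abbrev UB : Finset (Fin (d + 1) → ℤ) := boxDom (fun μ => (ℓ + 1) * i.Mp μ)

/-- the side vector of the fine box in the two-level presentation. [cite: Balaban1984PropagatorsII, (2.41) p.230, dictionary] -/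
abbrev NB : Fin (d + 1) → ℕ := fun μ => (ℓ + 1) ^ i.k * ((ℓ + 1) * i.Mp μ)

/-- the fine box in the two-level presentation (`= B4Lemma22ReduceZero.Box d ℓ k (L·M′)`, the carrier of `gTwoLevel`); `NB` its side vector.
[cite: Balaban1984PropagatorsII, (2.41) p.230, dictionary] -/
abbrev XB : Finset (Fin (d + 1) → ℤ) := boxDom i.NB

/-- the two presentations of the fine box have the same side vector (`N0 ℓ M_h (k+1) P = L^k·(L·M′)`). [cite: Balaban1984PropagatorsII, (2.41) p.230, dictionary] -/
theorem N0_eq : N0 ℓ i.Mh (i.k + 1) i.P = i.NB := by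
  funext μ; simp only [N0, NB, Mp]; ring

/-- membership in the fine box: the `Domains` presentation versus the two-level presentation. [cite: Balaban1984PropagatorsII, (2.41) p.230, dictionary] -/
theorem mem_XD_iff {x : Fin (d + 1) → ℤ} : x ∈ boxDom (N0 ℓ i.Mh (i.k + 1) i.P) ↔ x ∈ i.XB := by
  rw [i.N0_eq]

/-- the identity map on sites, from the two-level presentation to the `Domains` presentation. [cite: Balaban1984PropagatorsII, (2.41) p.230, dictionary] -/
def toD (x : ↥(i.XB)) : ↥(boxDom (N0 ℓ i.Mh (i.k + 1) i.P)) := ⟨x.1, i.mem_XD_iff.2 x.2⟩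

/-- the identity map on sites, from the `Domains` presentation to the two-level presentation. [cite: Balaban1984PropagatorsII, (2.41) p.230, dictionary] -/
def ofD (x : ↥(boxDom (N0 ℓ i.Mh (i.k + 1) i.P))) : ↥(i.XB) := ⟨x.1, i.mem_XD_iff.1 x.2⟩

/-- `toD` is the identity on sites. [cite: Balaban1984PropagatorsII, (2.41) p.230, dictionary] -/
@[simp] theorem toD_val (x : ↥(i.XB)) : (i.toD x).1 = x.1 := rfl
/-- `ofD` is the identity on sites. [cite: Balaban1984PropagatorsII, (2.41) p.230, dictionary] -/
@[simp] theorem ofD_val (x : ↥(boxDom (N0 ℓ i.Mh (i.k + 1) i.P))) : (i.ofD x).1 = x.1 := rfl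
/-- `toD ∘ ofD = id`. [cite: Balaban1984PropagatorsII, (2.41) p.230, dictionary] -/
@[simp] theorem toD_ofD (x : ↥(boxDom (N0 ℓ i.Mh (i.k + 1) i.P))) : i.toD (i.ofD x) = x := Subtype.ext rfl
/-- `ofD ∘ toD = id`. [cite: Balaban1984PropagatorsII, (2.41) p.230, dictionary] -/
@[simp] theorem ofD_toD (x : ↥(i.XB)) : i.ofD (i.toD x) = x := Subtype.ext rfl

/-- `0` is a site of the fine box (the box is non-empty). [cite: Balaban1984PropagatorsII, (2.41) p.230, dictionary] -/
theorem zero_mem_XB : (0 : Fin (d + 1) → ℤ) ∈ i.XB := by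
  rw [mem_boxDom]; intro μ
  have h1 : 1 ≤ ℓ + 1 := by omega
  have : 1 ≤ i.NB μ :=
    Nat.one_le_iff_ne_zero.2 (Nat.mul_ne_zero_iff.2 ⟨by positivity,
      Nat.mul_ne_zero_iff.2 ⟨by omega, Nat.mul_ne_zero_iff.2 ⟨by have := i.hMh; omega,
        Nat.mul_ne_zero_iff.2 ⟨by omega, by have := i.hP μ; omega⟩⟩⟩⟩)
  simp only [Pi.zero_apply]; exact ⟨le_rfl, by exact_mod_cast this⟩

/-- the fine box is non-empty (needed for the suprema `sup_x`). [cite: Balaban1984PropagatorsII, (2.41) p.230, dictionary] -/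
instance : Nonempty ↥(i.XB) := ⟨⟨0, i.zero_mem_XB⟩⟩

/-- **`Λ` OF THE TWO-LEVEL OPERATOR** = the level-`k` block labels lying in the big `(k+1)`-blocks of `Λb` (a union of `L`-blocks,
indeed of big blocks). [cite: Balaban1984PropagatorsII, (2.41) p.230 («Λ = □^{(j)} ∩ B(Λ_{j+1})»)] -/
def LamU : Finset ↥(i.UB) := Finset.univ.filter fun u => blk (i.Mh * (ℓ + 1)) (blk (ℓ + 1) u.1) ∈ i.Λb

/-- membership in `Λ`. [cite: Balaban1984PropagatorsII, (2.41) p.230, dictionary] -/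
theorem mem_LamU {u : ↥(i.UB)} : u ∈ i.LamU ↔ blk (i.Mh * (ℓ + 1)) (blk (ℓ + 1) u.1) ∈ i.Λb := by
  simp [LamU]

/-- `Λ` is a union of `L`-blocks (the hypothesis of the two-level lane). [cite: Balaban1984PropagatorsII, (2.41) p.230] -/
theorem isBlockUnion_LamU : IsBlockUnion ℓ i.Mp i.LamU := by
  intro y hy y' hb
  rw [mem_LamU] at hy ⊢
  rwa [hb]

/-- **HONESTY LINK `Λ` ↔ LEVELS**: a fine site has level `k + 1` iff its level-`k` block label lies in `Λ` — the `Λ` of the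
operator IS the region `B^{k+1}(Λ_{k+1})` of the geometry. [cite: Balaban1984PropagatorsII, (2.41) p.230 with (2.1)–(2.4) p.224] -/
theorem lev_eq_succ_iff (x : Fin (d + 1) → ℤ) :
    i.lev x = i.k + 1 ↔ blk (i.Mh * (ℓ + 1)) (blk (ℓ + 1) (blk i.n x)) ∈ i.Λb := by
  have e : blk (i.Mh * (ℓ + 1)) (blk (ℓ + 1) (blk i.n x)) = blk (bigSide ℓ i.Mh (i.k + 1)) x := by
    rw [blk_blk, blk_blk]; congr 1; simp only [bigSide, n]; ring
  rw [e]; unfold lev; split_ifs with h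
  · simp [h]
  · simp [h]

/-- **THE GENUINE TWO-LEVEL OPERATOR OF THE MEMBER**: `G′ = (Δ^{ξ,N}_X + Q′*aQ′)⁻¹ = gTwoLevel` with the PRINTED weights
`a_k = B1.aSeq 1 L k` (= `aPrinted ℓ 1 k`), `a_{k+1} = aNext ℓ a_k 1` (the recursion (2.14) with `a = 1`, «(a = 1)» of Prop. 2.2),
`m² = 0`, on the fine box of the member. [cite: Balaban1984PropagatorsII, Prop. 2.2 p.234 («G′ = Δ′_a^{−1} (a = 1)»), (2.13)–(2.14) p.225, (2.41)–(2.42) p.230] -/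
def G : Matrix ↥(i.XB) ↥(i.XB) ℝ := gTwoLevel i.n ℓ (aPrinted ℓ 1 i.k) 1 0 i.Mp i.LamU

/-! ## §3 The census geometry of the member and the (2.67) functionals of `G′` -/

/-- the block `y^j(x) ∈ 𝔅` of a fine site (through the `Domains` presentation). [cite: Balaban1984PropagatorsII, p.231 («x ∈ B^j(y)»)] -/
def blkD (x : ↥(i.XB)) : ↥(bset i.dom) := blkOf i.dom (i.toD x)

/-- every block of `𝔅` contains a fine site. [cite: Balaban1984PropagatorsII, (2.45) p.231] -/
theorem exists_blkD_eq (s : ↥(bset i.dom)) : ∃ x : ↥(i.XB), i.blkD x = s := by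
  obtain ⟨x₀, hx₀⟩ := exists_blkOf_eq i.dom s
  exact ⟨i.ofD x₀, by simpa [blkD] using hx₀⟩

/-- the levels present are `k` and `k + 1`. [cite: Balaban1984PropagatorsII, (2.1) p.224] -/
theorem scale_eq_or (s : ↥(bset i.dom)) : s.1.1 = i.k ∨ s.1.1 = i.k + 1 := by
  obtain ⟨x₀, hx₀⟩ := exists_blkOf_eq i.dom s
  have h := lev_eq_of_blkOf_eq (D := i.dom) hx₀
  rw [dom_lev] at h
  rcases i.lev_eq_or x₀.1 with e | e
  · left; rw [← h, e]
  · right; rw [← h, e]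

/-- the sup norm `|λ| = sup_x |λ(x)|` of a lattice function on the fine box. [cite: Balaban1984PropagatorsII, Prop. 2.2 (2.67) p.234 («|λ|»)] -/
def supF (f : ↥(i.XB) → ℝ) : ℝ := ⨆ x : ↥(i.XB), |f x|

/-- `0 ≤ |λ|`. [cite: Balaban1984PropagatorsII, Prop. 2.2 (2.67) p.234 («|λ|»), dictionary] -/
theorem supF_nonneg (f : ↥(i.XB) → ℝ) : 0 ≤ i.supF f := by
  unfold supF
  exact le_ciSup_of_le (Set.finite_range _).bddAbove ⟨0, i.zero_mem_XB⟩ (abs_nonneg _)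

/-- `|λ(x)| ≤ |λ|`. [cite: Balaban1984PropagatorsII, Prop. 2.2 (2.67) p.234 («|λ|»), dictionary] -/
theorem abs_le_supF (f : ↥(i.XB) → ℝ) (x : ↥(i.XB)) : |f x| ≤ i.supF f :=
  le_ciSup (Set.finite_range fun x : ↥(i.XB) => |f x|).bddAbove x

open Classical in
/-- the Hölder seminorm `‖f‖_α = sup_{x ≠ x′} |f(x′) − f(x)|/|x′ − x|^α` on the `ξ = L^{−k}` lattice (`|x′ − x| = |x′ − x|_∞/n`).
[cite: Balaban1984PropagatorsII, Prop. 2.2 (2.67) p.234 («‖ζ‖_α»); Balaban1984PropagatorsI, (1.109) p.35] -/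
def hq (α : ℝ) (f : ↥(i.XB) → ℝ) : ℝ :=
  ⨆ p : ↥(i.XB) × ↥(i.XB), if p.1 ≠ p.2 then |f p.2 - f p.1| / (supNorm (p.2.1 - p.1.1) / i.n) ^ α else 0

open Classical in
/-- the Hölder seminorm of a `μ`-BOND function `f` (a forward difference `∇^ξ_μg`, living on the bonds `⟨x, x + ξe_μ⟩ ⊂ X`):
`sup |f(x′) − f(x)|/|x′ − x|^α` over pairs of distinct sites which both carry a `μ`-bond of the box (on the print's torus
every site does; on the Neumann box of the lineage the far `μ`-face carries none).
[cite: Balaban1984PropagatorsII, Prop. 2.2 (2.67) p.234 («‖ζ∇G′λ‖_α»); Balaban1984PropagatorsI, (1.109) p.35, dictionary] -/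
def hqB (μ : Fin (d + 1)) (α : ℝ) (f : ↥(i.XB) → ℝ) : ℝ :=
  ⨆ p : ↥(i.XB) × ↥(i.XB), if p.1 ≠ p.2 ∧ p.1.1 + Pi.single μ 1 ∈ i.XB ∧ p.2.1 + Pi.single μ 1 ∈ i.XB then
    |f p.2 - f p.1| / (supNorm (p.2.1 - p.1.1) / i.n) ^ α else 0

open Classical in
/-- **THE CENSUS GEOMETRY OF THE MEMBER**: sites `𝔅` = the blocks of both levels (p21՚s `bset`), `scale` = level, `dist` = THE REALISED
DISTANCE (2.46) of `B6Geom246MultiLevelBox.geom` (graph distance of touching blocks, `Realizes`), `k + 1` levels, `η = ξ = L^{−k}`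
(the (2.40) units: level-`k` blocks are unit cubes, level-`(k+1)` blocks have side `L`), `L`, `R`, `M = L·M_h`; `Hyp21_22 := True`
because (2.1)–(2.2) are FIELDS of the `Domains` structure the member is built from; arguments `λ`, cut-offs `ζ` = lattice functions
on the fine box with `supp λ ⊂ B^j(y′)` / `supp ζ ⊂ B^j(y)` as `suppIn`/`cutIn`, `|λ| = supF`, `‖ζ‖_α + |ζ| = hq α ζ + supF ζ`.
[cite: Balaban1984PropagatorsII, (2.1)–(2.4) p.224, (2.45)–(2.46) p.231, Prop. 2.2 (2.67) p.234] -/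
def geo : Geometry :=
  { geom i.dom with
    eta := (((i.n : ℕ) : ℝ))⁻¹
    R := i.R
    M := ((ℓ : ℝ) + 1) * i.Mh
    Hyp21_22 := True
    Loc := ↥(i.XB) → ℝ
    suppIn := fun f s => ∀ x, f x ≠ 0 → i.blkD x = s
    supNorm := i.supF
    l2Norm := fun f => Real.sqrt (∑ x, f x ^ 2)
    holder := i.hq
    Cut := ↥(i.XB) → ℝ
    cutIn := fun ζ s => ∀ x, ζ x ≠ 0 → i.blkD x = s
    cutH := fun α ζ => i.hq α ζ + i.supF ζ
    cutSup := i.supF }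

/-- the sites of the census geometry are the blocks `𝔅` (2.45) of the member. [cite: Balaban1984PropagatorsII, (2.45) p.231, dictionary] -/
@[simp] theorem geo_Site : i.geo.Site = ↥(bset i.dom) := rfl
/-- `M = L·M_h`. [cite: Balaban1984PropagatorsII, p.229 («big blocks of the size ML^jη»), dictionary] -/
@[simp] theorem geo_M : i.geo.M = ((ℓ : ℝ) + 1) * i.Mh := rfl
/-- the hypothesis slot (2.1)–(2.2) is `True` (structure fields of `Domains`). [cite: Balaban1984PropagatorsII, (2.1)–(2.2) p.224, dictionary] -/
@[simp] theorem geo_Hyp : i.geo.Hyp21_22 = True := rfl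
/-- `dist` = the realised distance (2.46) (graph distance of touching blocks). [cite: Balaban1984PropagatorsII, (2.46) p.231, dictionary] -/
theorem geo_dist (s t : ↥(bset i.dom)) : i.geo.dist s t = (((bond i.dom).dist s t : ℕ) : ℝ) := rfl
/-- `scale` = the level of the block. [cite: Balaban1984PropagatorsII, (2.45) p.231, dictionary] -/
theorem geo_scale (s : ↥(bset i.dom)) : i.geo.scale s = s.1.1 := rfl
/-- `|λ|` = `supF`. [cite: Balaban1984PropagatorsII, Prop. 2.2 (2.67) p.234, dictionary] -/
theorem geo_supNorm (f : ↥(i.XB) → ℝ) : i.geo.supNorm f = i.supF f := rfl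
/-- `supp λ ⊂ B(y′)` unfolded. [cite: Balaban1984PropagatorsII, Prop. 2.2 p.234 («for λ with supp λ ⊂ B^{j′}(y′)»), dictionary] -/
theorem geo_suppIn (f : ↥(i.XB) → ℝ) (s : ↥(bset i.dom)) : i.geo.suppIn f s ↔ ∀ x, f x ≠ 0 → i.blkD x = s := Iff.rfl

/-- `L^jη ∈ {1, L}` on the member: `len y = L^{scale y}·L^{−k}`. [cite: Balaban1984PropagatorsII, (2.67) p.234 (the factors L^jη)] -/
theorem geo_len (s : ↥(bset i.dom)) : i.geo.len s = ((ℓ : ℝ) + 1) ^ s.1.1 * ((((ℓ + 1) ^ i.k : ℕ) : ℝ))⁻¹ := rfl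

/-- `1 ≤ L^jη` on the member (the two levels have `L^jη = 1` and `L`). [cite: Balaban1984PropagatorsII, (2.67) p.234] -/
theorem one_le_len (s : ↥(bset i.dom)) : 1 ≤ i.geo.len s := by
  rw [geo_len]
  have hL : (1 : ℝ) ≤ (ℓ : ℝ) + 1 := by linarith [(Nat.cast_nonneg ℓ : (0 : ℝ) ≤ ℓ)]
  have hn : (((ℓ + 1) ^ i.k : ℕ) : ℝ) = ((ℓ : ℝ) + 1) ^ i.k := by push_cast; ring
  rw [hn]
  have hpos : (0 : ℝ) < ((ℓ : ℝ) + 1) ^ i.k := by positivity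
  rw [le_mul_inv_iff₀ hpos, one_mul]
  rcases i.scale_eq_or s with e | e
  · rw [e]
  · rw [e, pow_succ]; exact le_mul_of_one_le_right hpos.le hL

/-! ## §4 The (2.67) functionals of `G′` on the member and the kernel-form ⇒ census-form conversion -/

open Classical in
/-- entry (2.67)₁: `sup_{x ∈ B^j(y)} |(G′λ)(x)|`. [cite: Balaban1984PropagatorsII, Prop. 2.2 (2.67) p.234] -/
def e0 (f : ↥(i.XB) → ℝ) (s : ↥(bset i.dom)) : ℝ :=
  ⨆ x : ↥(i.XB), if i.blkD x = s then |(i.G *ᵥ f) x| else 0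

open Classical in
/-- entry (2.67)₂: `sup_{x ∈ B^j(y), μ} |(∇^ξ_μG′λ)(x)|` (forward difference on the `ξ`-lattice; no bond leaves the box).
[cite: Balaban1984PropagatorsII, Prop. 2.2 (2.67) p.234] -/
def e1 (f : ↥(i.XB) → ℝ) (s : ↥(bset i.dom)) : ℝ :=
  ⨆ p : ↥(i.XB) × Fin (d + 1), if i.blkD p.1 = s then
    |(i.n : ℝ) * ((i.G *ᵥ f) (fwd i.NB p.2 p.1) - (i.G *ᵥ f) p.1)| else 0

open Classical in
/-- entry (2.67)₃: `sup_{x ∈ B^j(y), μ} |(G′∇^{ξ*}_μλ_μ)(x)|` — component `μ` of the bond field `λ` (the kernel `G′∇^{ξ*}_μ = dstar`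
of the two-level lane; the printed `|(G′∇*λ)(x)| ≤ Σ_μ …`). [cite: Balaban1984PropagatorsII, Prop. 2.2 (2.67) p.234] -/
def e2 (f : ↥(i.XB) → ℝ) (s : ↥(bset i.dom)) : ℝ :=
  ⨆ p : ↥(i.XB) × Fin (d + 1), if i.blkD p.1 = s then |(dstar i.n p.2 i.G *ᵥ f) p.1| else 0

open Classical in
/-- entry (2.67)₆: `sup_{x ∈ B^j(y)} |(Δ^ξG′λ)(x)|`. [cite: Balaban1984PropagatorsII, Prop. 2.2 (2.67) p.234] -/
def e3 (f : ↥(i.XB) → ℝ) (s : ↥(bset i.dom)) : ℝ :=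
  ⨆ x : ↥(i.XB), if i.blkD x = s then |((lapOp i.n i.NB * i.G) *ᵥ f) x| else 0

/-- the Hölder entries (2.67)₄,₅: `max_μ max(‖ζ∇^ξ_μG′λ‖_α, ‖ζG′∇^{ξ*}_μλ_μ‖_α)` — the `ζ`-dressed Hölder seminorms on the
`ξ`-lattice: the bond function `ζ∇^ξ_μG′λ` over pairs of `μ`-bonds of the box (`hqB`), the site function `ζG′∇^{ξ*}_μλ` over
pairs of sites (`hq`). [cite: Balaban1984PropagatorsII, Prop. 2.2 (2.67) p.234] -/
def hH (f : ↥(i.XB) → ℝ) (α : ℝ) (ζ : ↥(i.XB) → ℝ) : ℝ :=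
  ⨆ p : Fin (d + 1) × Bool, if p.2 then
      i.hqB p.1 α (fun x => ζ x * ((i.n : ℝ) * ((i.G *ᵥ f) (fwd i.NB p.1 x) - (i.G *ᵥ f) x)))
    else i.hq α (fun x => ζ x * (dstar i.n p.1 i.G *ᵥ f) x)

/-- **THE (2.67) FUNCTIONALS OF `G′` ON THE MEMBER** in the census record `B6.GpFamily`: entries `0, 1, 2, 5` of (2.67) and the Hölder slot.
[cite: Balaban1984PropagatorsII, Prop. 2.2 (2.67) p.234] -/
def gp : GpFamily i.geo where
  e := ![i.e0, i.e1, i.e2, i.e3]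
  h1 := i.hH

/-- entry `0` of `gp` is (2.67)₁. [cite: Balaban1984PropagatorsII, Prop. 2.2 (2.67) p.234, dictionary] -/
@[simp] theorem gp_e_zero : i.gp.e 0 = i.e0 := rfl
/-- entry `1` of `gp` is (2.67)₂. [cite: Balaban1984PropagatorsII, Prop. 2.2 (2.67) p.234, dictionary] -/
@[simp] theorem gp_e_one : i.gp.e 1 = i.e1 := rfl
/-- entry `2` of `gp` is (2.67)₃. [cite: Balaban1984PropagatorsII, Prop. 2.2 (2.67) p.234, dictionary] -/
@[simp] theorem gp_e_two : i.gp.e 2 = i.e2 := rfl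
/-- entry `3` of `gp` is (2.67)₆. [cite: Balaban1984PropagatorsII, Prop. 2.2 (2.67) p.234, dictionary] -/
@[simp] theorem gp_e_three : i.gp.e 3 = i.e3 := rfl

/-- **THE p. 232 COMPARISON FOR THE MEMBER**: every site has level `≥ k`, so `d(y(x), y(z)) ≤ (d+1)(|x − z|_∞/L^k + 1)` for ALL fine
sites (p21՚s `dist_blkOf_le_box`). [cite: Balaban1984PropagatorsII, p.232 (reading (2.43)–(2.44) in the form (2.53)), (2.46) p.231] -/
theorem dist_blkD_le (x z : ↥(i.XB)) :
    i.geo.dist (i.blkD x) (i.blkD z) ≤ (d + 1) * (supNorm (x.1 - z.1) / (i.n : ℕ) + 1) := by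
  rw [geo_dist]; unfold blkD
  have h := dist_blkOf_le_box (D := i.dom) i.hMh i.hP (i := i.k) (i.toD x) (i.toD z)
    (fun w _ _ => by rw [TLIdx.dom_lev]; exact i.k_le_lev w)
  simpa only [toD_val] using h

/-- **KERNEL FORM ⇒ CENSUS FORM**: for `λ` supported in the block `y′` and any row vector `g`,
`|Σ_z g(z)λ(z)| ≤ e^{δ}·e^{−(δ/(d+1))·d(y(x), y′)}·(Σ_z |g(z)|e^{δ|x−z|_∞/n})·|λ|` — the weighted-`ℓ¹` bounds of the two-level lane
become pointwise bounds decaying in the REALISED multiscale distance (2.46). [cite: Balaban1984PropagatorsII, p.232 + (2.53), (2.67) p.234] -/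
theorem abs_sum_mul_le {δ : ℝ} (hδ : 0 ≤ δ) (g f : ↥(i.XB) → ℝ) (x : ↥(i.XB)) (s' : ↥(bset i.dom))
    (hf : ∀ z, f z ≠ 0 → i.blkD z = s') :
    |∑ z, g z * f z| ≤ Real.exp δ * Real.exp (-(δ / (d + 1) * i.geo.dist (i.blkD x) s')) * wsum δ i.n x g * i.supF f := by
  set E : ℝ := Real.exp δ * Real.exp (-(δ / (d + 1) * i.geo.dist (i.blkD x) s')) with hE
  have hE0 : 0 ≤ E := by positivity
  have hS0 := i.supF_nonneg f
  have hw : wsum δ i.n x g = ∑ z, |g z| * Real.exp (δ * supNorm (x.1 - z.1) / (i.n : ℕ)) := rfl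
  have hterm : ∀ z, |g z * f z| ≤ |g z| * Real.exp (δ * supNorm (x.1 - z.1) / (i.n : ℕ)) * (E * i.supF f) := by
    intro z
    by_cases hz : f z = 0
    · rw [hz, mul_zero, abs_zero]; positivity
    · have hs : i.blkD z = s' := hf z hz
      have hd : i.geo.dist (i.blkD x) s' ≤ (d + 1) * (supNorm (x.1 - z.1) / (i.n : ℕ) + 1) := hs ▸ i.dist_blkD_le x z
      have hd1 : (0 : ℝ) < (d : ℝ) + 1 := by positivity
      have hkey : 1 ≤ Real.exp (δ * supNorm (x.1 - z.1) / (i.n : ℕ)) * E := by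
        rw [hE, ← Real.exp_add, ← Real.exp_add]
        apply Real.one_le_exp
        have : δ / (d + 1) * i.geo.dist (i.blkD x) s' ≤ δ / (d + 1) * ((d + 1) * (supNorm (x.1 - z.1) / (i.n : ℕ) + 1)) :=
          mul_le_mul_of_nonneg_left hd (div_nonneg hδ hd1.le)
        have e : δ / (d + 1) * ((d + 1) * (supNorm (x.1 - z.1) / (i.n : ℕ) + 1))
            = δ * supNorm (x.1 - z.1) / (i.n : ℕ) + δ := by field_simp
        linarith
      rw [abs_mul]
      calc |g z| * |f z| ≤ |g z| * i.supF f := mul_le_mul_of_nonneg_left (i.abs_le_supF f z) (abs_nonneg _)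
        _ = |g z| * 1 * i.supF f := by ring
        _ ≤ |g z| * (Real.exp (δ * supNorm (x.1 - z.1) / (i.n : ℕ)) * E) * i.supF f :=
          mul_le_mul_of_nonneg_right (mul_le_mul_of_nonneg_left hkey (abs_nonneg _)) hS0
        _ = |g z| * Real.exp (δ * supNorm (x.1 - z.1) / (i.n : ℕ)) * (E * i.supF f) := by ring
  calc |∑ z, g z * f z| ≤ ∑ z, |g z * f z| := Finset.abs_sum_le_sum_abs _ _
    _ ≤ ∑ z, |g z| * Real.exp (δ * supNorm (x.1 - z.1) / (i.n : ℕ)) * (E * i.supF f) := Finset.sum_le_sum fun z _ => hterm z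
    _ = E * wsum δ i.n x g * i.supF f := by rw [← Finset.sum_mul, hw]; ring

/-- matrix rows: `(Tλ)(x) = Σ_z T(x,z)λ(z)`. [folklore] -/
private theorem mulVec_eq_sum (T : Matrix ↥(i.XB) ↥(i.XB) ℝ) (f : ↥(i.XB) → ℝ) (x : ↥(i.XB)) :
    (T *ᵥ f) x = ∑ z, T x z * f z := rfl

/-- the weighted row functional `roww` of the lineage is the `wsum` of the row. [folklore] -/
private theorem roww_eq_wsum (δ : ℝ) (T : Matrix ↥(i.XB) ↥(i.XB) ℝ) (x : ↥(i.XB)) :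
    roww δ i.n T x = wsum δ i.n x (fun z => T x z) := rfl

/-- difference of two rows applied to `λ`. [folklore] -/
private theorem mulVec_sub_eq_sum (T : Matrix ↥(i.XB) ↥(i.XB) ℝ) (f : ↥(i.XB) → ℝ) (a b : ↥(i.XB)) (c : ℝ) :
    c * ((T *ᵥ f) a - (T *ᵥ f) b) = ∑ z, (c * (T a z - T b z)) * f z := by
  simp only [mulVec_eq_sum, ← Finset.sum_sub_distrib, Finset.mul_sum]
  refine Finset.sum_congr rfl fun z _ => ?_
  ring

/-- the printed prefactors are `≥ 1` when `L^jη ≥ 1`. [cite: Balaban1984PropagatorsII, (2.67) p.234] -/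
theorem one_le_pref4 {t : ℝ} (ht : 1 ≤ t) (m : Fin 4) : 1 ≤ pref4 t m := by
  fin_cases m
  · show 1 ≤ t ^ 2; nlinarith
  · show 1 ≤ t; exact ht
  · show 1 ≤ t; exact ht
  · show (1 : ℝ) ≤ 1; exact le_rfl

/-- a supremum of block-restricted values is bounded by a nonnegative bound of the values. [folklore] -/
private theorem ciSup_ite_le {ι : Type*} [Nonempty ι] {P : ι → Prop} [DecidablePred P] {F : ι → ℝ} {B : ℝ} (hB : 0 ≤ B)
    (h : ∀ j, P j → F j ≤ B) : (⨆ j, if P j then F j else 0) ≤ B :=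
  ciSup_le fun j => by split_ifs with hj <;> [exact h j hj; exact hB]

end TLIdx

/-! ## §5 The four sup entries of (2.67) in census form on the two-level family -/

open TLIdx in
/-- **PROPOSITION 2.2 (2.67), THE FOUR SUP ENTRIES, IN THE CENSUS TYPING ON THE GENUINELY TWO-LEVEL FAMILY** — literally the first
conjunct of the verbatim `B6.Prop22Printed geo gp` over the index family `TLIdx d ℓ` (every mesh `k ≥ 1`, every `M_h`, every volume `P`,
every set `Λb` of big `(k+1)`-blocks = every two-level nested family (2.1)–(2.2) on a Neumann box): there are `M₁, δ₀, C > 0` (depending on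
`d` and `L` only) such that for every member with `M = L·M_h ≥ M₁` («M sufficiently large»), every entry `m ∈ {0,1,2,3}` (= (2.67)₁,₂,₃,₆),
every `λ` with `supp λ ⊂ B^{j′}(y′)` and every block `y`:
`e_m(λ, y) ≤ C·[(L^jη)², L^jη, L^jη, 1]_m·e^{−½δ₀·d(y,y′)}·|λ|`, `d` = the REALISED distance (2.46), `G′ = (Δ^{ξ,N} + Q′*aQ′)⁻¹` the genuine
two-level operator with the printed weights (a = 1).  From p21՚s kernel-form package `B6Prop22AllTwoLevelBox.prop22_six_twoLevelBox`
(at `α = 0`) by `abs_sum_mul_le`. [cite: Balaban1984PropagatorsII, Prop. 2.2 (2.67) p.234 (entries 1–3 and 6); (2.46) p.231; p.232] -/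
theorem prop22_supEntries_twoLevel (d ℓ : ℕ) (hℓ : 1 ≤ ℓ) :
    ∃ M₁ δ₀ C : ℝ, 0 < M₁ ∧ 0 < δ₀ ∧ 0 < C ∧
      ∀ i : TLIdx d ℓ, i.geo.Hyp21_22 → M₁ ≤ i.geo.M →
        ∀ (m : Fin 4) (lam : i.geo.Loc) (y y' : i.geo.Site), i.geo.suppIn lam y' →
          i.gp.e m lam y ≤ C * pref4 (i.geo.len y) m * Real.exp (-(δ₀ / 2 * i.geo.dist y y')) * i.geo.supNorm lam := by
  -- the windows of the printed weights: a_k = aPrinted ℓ 1 k ∈ [1 − L^{−2}, 1], a = 1, m² = 0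
  set amin : ℝ := 1 - ((((ℓ : ℝ) + 1)) ^ 2)⁻¹ with hamin_def
  have hL2 : (1 : ℝ) < (((ℓ : ℝ) + 1)) ^ 2 := by
    have : (2 : ℝ) ≤ (ℓ : ℝ) + 1 := by
      have : (1 : ℝ) ≤ ℓ := by exact_mod_cast hℓ
      linarith
    nlinarith
  have hamin : 0 < amin := by
    rw [hamin_def, sub_pos]
    exact inv_lt_one_of_one_lt₀ hL2
  obtain ⟨δA, M0, CA, hδA, hM0, hCA, hAll⟩ :=
    prop22_six_twoLevelBox d ℓ hℓ amin 1 0 1 1 hamin one_pos 0 le_rfl zero_lt_one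
  refine ⟨max M0 (3 * ((ℓ : ℝ) + 1)), 2 * (δA / (d + 1)), CA * Real.exp δA, lt_max_of_lt_left hM0, by positivity,
    by positivity, ?_⟩
  intro i _ hM m lam y y' hsupp
  -- thresholds: M₀ ≤ L·M_h and M_h ≥ 3
  rw [geo_M] at hM
  have hM0' : M0 ≤ ((ℓ : ℝ) + 1) * i.Mh := le_trans (le_max_left _ _) hM
  have hMh3 : 3 ≤ i.Mh := by
    have h3 : 3 * ((ℓ : ℝ) + 1) ≤ ((ℓ : ℝ) + 1) * i.Mh := le_trans (le_max_right _ _) hM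
    have hL : (0 : ℝ) < (ℓ : ℝ) + 1 := by positivity
    have : (3 : ℝ) ≤ i.Mh := by nlinarith
    exact_mod_cast this
  -- the printed weights lie in the windows
  obtain ⟨haj1, haj2, _⟩ := aPrinted_window hℓ one_pos i.hk
  rw [one_mul] at haj1
  -- p21's six kernel-form bounds for THIS member (α = 0); only the sup entries 1, 2, 3, 6 are used
  obtain ⟨h1, h2, h3, -, -, h6⟩ := hAll i.k i.hk (aPrinted ℓ 1 i.k) 0 1 haj1 haj2 le_rfl le_rfl le_rfl le_rfl i.Mh hMh3 hM0'
    (fun μ => (ℓ + 1) * i.P μ) (fun μ => Nat.one_le_iff_ne_zero.2 (Nat.mul_ne_zero_iff.2 ⟨by omega, by have := i.hP μ; omega⟩))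
    i.LamU i.isBlockUnion_LamU
  -- read them on the member's operator `i.G`
  have h1' : ∀ x : ↥(i.XB), roww δA i.n i.G x ≤ CA := h1
  have h2' : ∀ (μ : Fin (d + 1)) (x xe : ↥(i.XB)), xe.1 = x.1 + Pi.single μ 1 →
      wsum δA i.n x (fun z => ((i.n : ℕ) : ℝ) * (i.G xe z - i.G x z)) ≤ CA := h2
  have h3' : ∀ (μ : Fin (d + 1)) (x : ↥(i.XB)), roww δA i.n (dstar i.n μ i.G) x ≤ CA := h3
  have h6' : ∀ x : ↥(i.XB), roww δA i.n (lapOp i.n i.NB * i.G) x ≤ CA := h6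
  -- common shape of the target
  have hδ2 : 2 * (δA / (d + 1)) / 2 = δA / (d + 1) := by ring
  rw [hδ2, geo_supNorm]
  rw [geo_suppIn] at hsupp
  set E : ℝ := Real.exp (-(δA / (d + 1) * i.geo.dist y y')) with hE
  have hE0 : 0 ≤ E := (Real.exp_pos _).le
  have hS0 := i.supF_nonneg lam
  have hpref : 1 ≤ pref4 (i.geo.len y) m := one_le_pref4 (i.one_le_len y) m
  -- the generic bound B := CA·e^{δA}·E·|λ| and its comparison with the printed right side
  have hB0 : 0 ≤ CA * Real.exp δA * E * i.supF lam := by positivity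
  have hBle : CA * Real.exp δA * E * i.supF lam ≤ CA * Real.exp δA * pref4 (i.geo.len y) m * E * i.supF lam := by
    have : CA * Real.exp δA * E * i.supF lam * 1 ≤ CA * Real.exp δA * E * i.supF lam * pref4 (i.geo.len y) m :=
      mul_le_mul_of_nonneg_left hpref hB0
    linarith
  refine le_trans ?_ hBle
  -- the conversion of one kernel-form row bound at a site `x ∈ B(y)`
  have conv : ∀ (g : ↥(i.XB) → ℝ) (x : ↥(i.XB)), i.blkD x = y → wsum δA i.n x g ≤ CA →
      |∑ z, g z * lam z| ≤ CA * Real.exp δA * E * i.supF lam := by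
    intro g x hx hg
    have h := i.abs_sum_mul_le hδA.le g lam x y' hsupp
    rw [hx] at h
    refine h.trans ?_
    have : Real.exp δA * E * wsum δA i.n x g * i.supF lam ≤ Real.exp δA * E * CA * i.supF lam :=
      mul_le_mul_of_nonneg_right (mul_le_mul_of_nonneg_left hg (by positivity)) hS0
    linarith
  fin_cases m
  · -- (2.67)₁ : |(G′λ)(x)|
    show i.e0 lam y ≤ _
    refine ciSup_ite_le hB0 fun x hx => ?_
    rw [mulVec_eq_sum]
    exact conv _ x hx (by rw [← roww_eq_wsum]; exact h1' x)
  · -- (2.67)₂ : |(∇^ξ_μ G′λ)(x)|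
    show i.e1 lam y ≤ _
    refine ciSup_ite_le hB0 fun p hx => ?_
    by_cases hmem : p.1.1 + Pi.single p.2 1 ∈ i.XB
    · have hfwd : (fwd i.NB p.2 p.1).1 = p.1.1 + Pi.single p.2 1 :=
        B4Lemma22ZeroBoxDerivDual.fwd_val_of_mem p.2 p.1 hmem
      rw [mulVec_sub_eq_sum]
      exact conv _ p.1 hx (h2' p.2 p.1 _ hfwd)
    · have hfwd : fwd i.NB p.2 p.1 = p.1 := B4Lemma22ZeroBoxDerivDual.fwd_of_not_mem p.2 p.1 hmem
      rw [hfwd, sub_self, mul_zero, abs_zero]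
      exact hB0
  · -- (2.67)₃ : |(G′∇^{ξ*}_μ λ_μ)(x)|
    show i.e2 lam y ≤ _
    refine ciSup_ite_le hB0 fun p hx => ?_
    rw [mulVec_eq_sum]
    exact conv _ p.1 hx (by rw [← roww_eq_wsum]; exact h3' p.2 p.1)
  · -- (2.67)₆ : |(Δ^ξ G′λ)(x)|
    show i.e3 lam y ≤ _
    refine ciSup_ite_le hB0 fun x hx => ?_
    rw [mulVec_eq_sum]
    exact conv _ x hx (by rw [← roww_eq_wsum]; exact h6' x)

/-! ## §6 Non-vacuity: members with BOTH levels present beyond every threshold «M sufficiently large» -/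

namespace TLIdx

/-- the member with ONE big block of level `k + 1` (label `0`) on the box of two big blocks per direction, big-block parameter `M_h`.
[cite: Balaban1984PropagatorsII, (2.1) p.224] -/
def twoBlock (d ℓ k Mh : ℕ) (hk : 1 ≤ k) (hMh : 1 ≤ Mh) : TLIdx d ℓ :=
  ⟨k, Mh, 0, fun _ => 2, {0}, hk, hMh, fun _ => by norm_num⟩

variable {ℓ : ℕ}

/-- the origin has level `k + 1` in `twoBlock`. [cite: Balaban1984PropagatorsII, (2.1) p.224] -/
theorem twoBlock_lev_zero (d k Mh : ℕ) (hk : 1 ≤ k) (hMh : 1 ≤ Mh) :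
    (twoBlock d ℓ k Mh hk hMh).lev 0 = k + 1 := by
  unfold lev twoBlock
  have hb : blk (bigSide ℓ Mh (k + 1)) (0 : Fin (d + 1) → ℤ) = 0 := by
    funext μ; simp [blk]
  simp [hb]

/-- the corner of the neighbouring big block (first direction) is a site of the box … [cite: Balaban1984PropagatorsII, (2.1) p.224] -/
theorem twoBlock_corner_mem (d k Mh : ℕ) (hk : 1 ≤ k) (hMh : 1 ≤ Mh) :
    (fun μ : Fin (d + 1) => if μ = 0 then ((bigSide ℓ Mh (k + 1) : ℕ) : ℤ) else 0) ∈ (twoBlock d ℓ k Mh hk hMh).XB := by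
  rw [mem_boxDom]; intro μ
  have hside : (twoBlock d ℓ k Mh hk hMh).NB μ = 2 * bigSide ℓ Mh (k + 1) := by
    simp only [NB, Mp, twoBlock, bigSide]; ring
  rw [hside]
  have hpos : 1 ≤ bigSide ℓ Mh (k + 1) := B6MultiLevelBoxOperator.one_le_bigSide hMh _
  split_ifs
  · constructor
    · positivity
    · push_cast; linarith [(show (1 : ℤ) ≤ bigSide ℓ Mh (k + 1) by exact_mod_cast hpos)]
  · constructor
    · exact le_rfl
    · push_cast; positivity

/-- … and has level `k`. [cite: Balaban1984PropagatorsII, (2.1) p.224] -/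
theorem twoBlock_lev_corner (d k Mh : ℕ) (hk : 1 ≤ k) (hMh : 1 ≤ Mh) :
    (twoBlock d ℓ k Mh hk hMh).lev (fun μ : Fin (d + 1) => if μ = 0 then ((bigSide ℓ Mh (k + 1) : ℕ) : ℤ) else 0) = k := by
  unfold lev
  have hpos : 1 ≤ bigSide ℓ Mh (k + 1) := B6MultiLevelBoxOperator.one_le_bigSide hMh _
  have hb : blk (bigSide ℓ Mh (k + 1)) (fun μ : Fin (d + 1) => if μ = 0 then ((bigSide ℓ Mh (k + 1) : ℕ) : ℤ) else 0)
      = fun μ => if μ = 0 then 1 else 0 := by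
    funext μ; simp only [blk]
    have hne : ((bigSide ℓ Mh (k + 1) : ℕ) : ℤ) ≠ 0 := by exact_mod_cast (by omega : bigSide ℓ Mh (k + 1) ≠ 0)
    split_ifs
    · exact Int.ediv_self hne
    · simp
  have hnot : (fun μ : Fin (d + 1) => if μ = 0 then (1 : ℤ) else 0) ∉ ({0} : Finset (Fin (d + 1) → ℤ)) := by
    rw [Finset.mem_singleton]; intro h
    have := congrFun h 0; simp at this
  simp only [twoBlock] at hb hnot ⊢
  rw [hb, if_neg hnot]

end TLIdx

open TLIdx in
/-- **NON-VACUITY OF THE TWO-LEVEL FAMILY**: for every mesh `k ≥ 1` and every threshold `M₁` there is a member with `M = L·M_h ≥ M₁` whose geometry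
has blocks at BOTH levels `k` and `k + 1` (so `prop22_supEntries_twoLevel` is a statement about genuinely two-level multiscale geometries with the
level-dependent factors `L^jη ∈ {1, L}` and the two-level distance (2.46)). [cite: Balaban1984PropagatorsII, (2.1)–(2.2) p.224, Prop. 2.2 p.234 («M is sufficiently large»)] -/
theorem twoLevel_nonvacuous (d ℓ k : ℕ) (hk : 1 ≤ k) (M₁ : ℝ) :
    ∃ i : TLIdx d ℓ, i.k = k ∧ M₁ ≤ i.geo.M ∧ i.geo.Hyp21_22 ∧
      (∃ s : i.geo.Site, i.geo.scale s = k + 1) ∧ (∃ s : i.geo.Site, i.geo.scale s = k) := by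
  set Mh : ℕ := max 1 ⌈M₁⌉₊ with hMh_def
  have hMh : 1 ≤ Mh := le_max_left _ _
  refine ⟨twoBlock d ℓ k Mh hk hMh, rfl, ?_, trivial, ?_, ?_⟩
  · rw [geo_M]
    have h1 : M₁ ≤ (Mh : ℝ) := le_trans (Nat.le_ceil M₁) (by exact_mod_cast le_max_right 1 ⌈M₁⌉₊)
    have h2 : (Mh : ℝ) ≤ ((ℓ : ℝ) + 1) * Mh := by
      have : (0 : ℝ) ≤ Mh := Nat.cast_nonneg Mh
      nlinarith [(Nat.cast_nonneg ℓ : (0 : ℝ) ≤ ℓ)]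
    exact h1.trans h2
  · refine ⟨(twoBlock d ℓ k Mh hk hMh).blkD ⟨0, (twoBlock d ℓ k Mh hk hMh).zero_mem_XB⟩, ?_⟩
    rw [geo_scale]; unfold TLIdx.blkD
    rw [← lev_eq_of_blkOf_eq (D := (twoBlock d ℓ k Mh hk hMh).dom) rfl]
    exact twoBlock_lev_zero d k Mh hk hMh
  · refine ⟨(twoBlock d ℓ k Mh hk hMh).blkD ⟨_, twoBlock_corner_mem d k Mh hk hMh⟩, ?_⟩
    rw [geo_scale]; unfold TLIdx.blkD
    rw [← lev_eq_of_blkOf_eq (D := (twoBlock d ℓ k Mh hk hMh).dom) rfl]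
    exact twoBlock_lev_corner d k Mh hk hMh

/-! ## §7 The Hölder entries (2.67)₄,₅ in census form, FOR EACH `α` (quantifier order `∀ α ∃ δ₀(α) C(α)`) -/

namespace TLIdx

variable {ℓ : ℕ} (i : TLIdx d ℓ)

/-- distinct lattice sites are at sup-distance `≥ 1`. [folklore] -/
private theorem one_le_supNorm_sub {a b : Fin (d + 1) → ℤ} (h : a ≠ b) : 1 ≤ supNorm (a - b) := by
  obtain ⟨j, hj⟩ : ∃ j, a j ≠ b j := by
    by_contra hc
    push Not at hc
    exact h (funext hc)
  have h1 : (1 : ℝ) ≤ (((|(a - b) j| : ℤ)) : ℝ) := by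
    have : (1 : ℤ) ≤ |(a - b) j| := by
      rw [Pi.sub_apply]
      exact Int.one_le_abs (sub_ne_zero.2 hj)
    exact_mod_cast this
  exact h1.trans (abs_le_supNorm (a - b) j)

/-- `0 ≤ ‖f‖_α`. [cite: Balaban1984PropagatorsII, Prop. 2.2 (2.67) p.234 («‖ζ‖_α»), dictionary] -/
theorem hq_nonneg (α : ℝ) (f : ↥(i.XB) → ℝ) : 0 ≤ i.hq α f := by
  classical
  unfold hq
  exact le_ciSup_of_le (Set.finite_range _).bddAbove (⟨0, i.zero_mem_XB⟩, ⟨0, i.zero_mem_XB⟩) (by simp)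

/-- one pair is bounded by the Hölder seminorm: `|f(x′) − f(x)|/|x′ − x|^α ≤ ‖f‖_α`.
[cite: Balaban1984PropagatorsII, Prop. 2.2 (2.67) p.234 («‖ζ‖_α»), dictionary] -/
theorem pair_le_hq (α : ℝ) (f : ↥(i.XB) → ℝ) (x x' : ↥(i.XB)) (hne : x ≠ x') :
    |f x' - f x| / (supNorm (x'.1 - x.1) / i.n) ^ α ≤ i.hq α f := by
  classical
  unfold hq
  have h := le_ciSup (Set.finite_range fun p : ↥(i.XB) × ↥(i.XB) =>
    if p.1 ≠ p.2 then |f p.2 - f p.1| / (supNorm (p.2.1 - p.1.1) / i.n) ^ α else 0).bddAbove (x, x')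
  simp only [ne_eq, hne, not_false_eq_true, if_true] at h
  exact h

/-- `1 ≤ n = L^k`. [cite: Balaban1984PropagatorsII, (2.40) p.230, dictionary] -/
theorem one_le_n : 1 ≤ i.n := Nat.one_le_pow _ _ (by omega)

/-- the pair quotient as a weighted value: `|v|/(|x′−x|/n)^α = |(n/|x′−x|)^α·v|` (`x′ ≠ x`).
[cite: Balaban1984PropagatorsI, (1.109) p.35, dictionary] -/
theorem quot_eq_abs_weight (α : ℝ) (x x' : ↥(i.XB)) (hne : x'.1 ≠ x.1) (v : ℝ) :
    |v| / (supNorm (x'.1 - x.1) / i.n) ^ α = |(((i.n : ℕ) : ℝ) / supNorm (x'.1 - x.1)) ^ α * v| := by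
  have hs : 0 < supNorm (x'.1 - x.1) := lt_of_lt_of_le one_pos (one_le_supNorm_sub hne)
  have hn : (0 : ℝ) < ((i.n : ℕ) : ℝ) := by exact_mod_cast lt_of_lt_of_le Nat.one_pos i.one_le_n
  have hw : 0 < (((i.n : ℕ) : ℝ) / supNorm (x'.1 - x.1)) ^ α := Real.rpow_pos_of_pos (div_pos hn hs) α
  rw [abs_mul, abs_of_pos hw, Real.div_rpow hs.le hn.le, Real.div_rpow hn.le hs.le, div_div_eq_mul_div]
  have h1 : 0 < supNorm (x'.1 - x.1) ^ α := Real.rpow_pos_of_pos hs α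
  have h2 : 0 < (((i.n : ℕ) : ℝ)) ^ α := Real.rpow_pos_of_pos hn α
  field_simp

/-- a weighted difference of two sums against `λ` is one sum. [folklore] -/
private theorem mul_sub_sum (c : ℝ) (a b f : ↥(i.XB) → ℝ) :
    c * (∑ z, a z * f z - ∑ z, b z * f z) = ∑ z, (c * (a z - b z)) * f z := by
  rw [← Finset.sum_sub_distrib, Finset.mul_sum]
  exact Finset.sum_congr rfl fun z _ => by ring

/-- **KERNEL FORM ⇒ CENSUS FORM, TWO CENTRES**: for `x, x′ ∈ B(y)`, `supp λ ⊂ B(y′)` and any row vector `g`,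
`|Σ_z g(z)λ(z)| ≤ e^{δ}·e^{−(δ/(d+1))·d(y,y′)}·(Σ_z |g(z)|e^{δ·min(|x−z|_∞,|x′−z|_∞)/n})·|λ|` — the two-centre weighted bounds
of the Hölder entries of the lineage ([3] (1.9): `dist({x,x′}, z)`) become bounds decaying in the realised distance (2.46).
[cite: Balaban1984PropagatorsII, p.232 + (2.53), (2.67) p.234; Balaban1983RegularityDecay, Thm (1.9) p.573] -/
theorem abs_sum_mul_le2 {δ : ℝ} (hδ : 0 ≤ δ) (g f : ↥(i.XB) → ℝ) (x x' : ↥(i.XB)) (s s' : ↥(bset i.dom))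
    (hx : i.blkD x = s) (hx' : i.blkD x' = s) (hf : ∀ z, f z ≠ 0 → i.blkD z = s') :
    |∑ z, g z * f z| ≤ Real.exp δ * Real.exp (-(δ / (d + 1) * i.geo.dist s s')) * wsum2 δ i.n x x' g * i.supF f := by
  set E : ℝ := Real.exp δ * Real.exp (-(δ / (d + 1) * i.geo.dist s s')) with hE
  have hE0 : 0 ≤ E := by positivity
  have hS0 := i.supF_nonneg f
  have hw : wsum2 δ i.n x x' g
      = ∑ z, |g z| * Real.exp (δ * min (supNorm (x.1 - z.1)) (supNorm (x'.1 - z.1)) / (i.n : ℕ)) := rfl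
  have hterm : ∀ z, |g z * f z|
      ≤ |g z| * Real.exp (δ * min (supNorm (x.1 - z.1)) (supNorm (x'.1 - z.1)) / (i.n : ℕ)) * (E * i.supF f) := by
    intro z
    by_cases hz : f z = 0
    · rw [hz, mul_zero, abs_zero]; positivity
    · have hs : i.blkD z = s' := hf z hz
      have hd : i.geo.dist s s' ≤ (d + 1) * (supNorm (x.1 - z.1) / (i.n : ℕ) + 1) := hx ▸ hs ▸ i.dist_blkD_le x z
      have hd' : i.geo.dist s s' ≤ (d + 1) * (supNorm (x'.1 - z.1) / (i.n : ℕ) + 1) := hx' ▸ hs ▸ i.dist_blkD_le x' z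
      have hd1 : (0 : ℝ) < (d : ℝ) + 1 := by positivity
      have hmin : i.geo.dist s s'
          ≤ (d + 1) * (min (supNorm (x.1 - z.1)) (supNorm (x'.1 - z.1)) / (i.n : ℕ) + 1) := by
        rcases min_choice (supNorm (x.1 - z.1)) (supNorm (x'.1 - z.1)) with h | h <;> rw [h]
        · exact hd
        · exact hd'
      have hkey : 1 ≤ Real.exp (δ * min (supNorm (x.1 - z.1)) (supNorm (x'.1 - z.1)) / (i.n : ℕ)) * E := by
        rw [hE, ← Real.exp_add, ← Real.exp_add]
        apply Real.one_le_exp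
        have : δ / (d + 1) * i.geo.dist s s'
            ≤ δ / (d + 1) * ((d + 1) * (min (supNorm (x.1 - z.1)) (supNorm (x'.1 - z.1)) / (i.n : ℕ) + 1)) :=
          mul_le_mul_of_nonneg_left hmin (div_nonneg hδ hd1.le)
        have e : δ / (d + 1) * ((d + 1) * (min (supNorm (x.1 - z.1)) (supNorm (x'.1 - z.1)) / (i.n : ℕ) + 1))
            = δ * min (supNorm (x.1 - z.1)) (supNorm (x'.1 - z.1)) / (i.n : ℕ) + δ := by field_simp
        linarith
      rw [abs_mul]
      calc |g z| * |f z| ≤ |g z| * i.supF f := mul_le_mul_of_nonneg_left (i.abs_le_supF f z) (abs_nonneg _)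
        _ = |g z| * 1 * i.supF f := by ring
        _ ≤ |g z| * (Real.exp (δ * min (supNorm (x.1 - z.1)) (supNorm (x'.1 - z.1)) / (i.n : ℕ)) * E) * i.supF f :=
          mul_le_mul_of_nonneg_right (mul_le_mul_of_nonneg_left hkey (abs_nonneg _)) hS0
        _ = |g z| * Real.exp (δ * min (supNorm (x.1 - z.1)) (supNorm (x'.1 - z.1)) / (i.n : ℕ)) * (E * i.supF f) := by
          ring
  calc |∑ z, g z * f z| ≤ ∑ z, |g z * f z| := Finset.abs_sum_le_sum_abs _ _
    _ ≤ ∑ z, |g z| * Real.exp (δ * min (supNorm (x.1 - z.1)) (supNorm (x'.1 - z.1)) / (i.n : ℕ)) * (E * i.supF f) :=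
      Finset.sum_le_sum fun z _ => hterm z
    _ = E * wsum2 δ i.n x x' g * i.supF f := by rw [← Finset.sum_mul, hw]; ring

/-- a bound of every pair quotient bounds the Hölder seminorm. [cite: Balaban1984PropagatorsII, Prop. 2.2 (2.67) p.234 («‖·‖_α»), dictionary] -/
theorem hq_le_of_forall (α : ℝ) (f : ↥(i.XB) → ℝ) {Bd : ℝ} (h0 : 0 ≤ Bd)
    (h : ∀ x x' : ↥(i.XB), x ≠ x' → |f x' - f x| / (supNorm (x'.1 - x.1) / i.n) ^ α ≤ Bd) : i.hq α f ≤ Bd := by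
  classical
  unfold hq
  refine ciSup_le fun p => ?_
  split_ifs with hne
  · exact h p.1 p.2 hne
  · exact h0

/-- a bound of every bond-pair quotient bounds the bond Hölder seminorm. [cite: Balaban1984PropagatorsII, Prop. 2.2 (2.67) p.234 («‖ζ∇G′λ‖_α»), dictionary] -/
theorem hqB_le_of_forall (μ : Fin (d + 1)) (α : ℝ) (f : ↥(i.XB) → ℝ) {Bd : ℝ} (h0 : 0 ≤ Bd)
    (h : ∀ x x' : ↥(i.XB), x ≠ x' → x.1 + Pi.single μ 1 ∈ i.XB → x'.1 + Pi.single μ 1 ∈ i.XB →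
      |f x' - f x| / (supNorm (x'.1 - x.1) / i.n) ^ α ≤ Bd) : i.hqB μ α f ≤ Bd := by
  classical
  unfold hqB
  refine ciSup_le fun p => ?_
  split_ifs with hc
  · exact h p.1 p.2 hc.1 hc.2.1 hc.2.2
  · exact h0

/-- a common bound of the `2(d+1)` dressed seminorms bounds the Hölder slot. [cite: Balaban1984PropagatorsII, Prop. 2.2 (2.67) p.234, dictionary] -/
theorem hH_le_of_forall (f : ↥(i.XB) → ℝ) (α : ℝ) (ζ : ↥(i.XB) → ℝ) {Bd : ℝ}
    (hB : ∀ μ, i.hqB μ α (fun x => ζ x * (((i.n : ℕ) : ℝ) * ((i.G *ᵥ f) (fwd i.NB μ x) - (i.G *ᵥ f) x))) ≤ Bd)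
    (hS : ∀ μ, i.hq α (fun x => ζ x * (dstar i.n μ i.G *ᵥ f) x) ≤ Bd) : i.hH f α ζ ≤ Bd := by
  classical
  unfold hH
  refine ciSup_le fun p => ?_
  rcases p with ⟨μ, b⟩
  cases b
  · simp only [Bool.false_eq_true, ↓reduceIte]; exact hS μ
  · simp only [↓reduceIte]; exact hB μ

/-- **THE PRODUCT RULE FOR ONE PAIR** of the `ζ`-dressed Hölder quotient, `supp ζ ⊂ B(y)`: if `|F| ≤ S` on `B(y)` (at the two
sites) and `|F(x′) − F(x)|/|x′−x|^α ≤ H` when both sites lie in `B(y)`, then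
`|ζ(x′)F(x′) − ζ(x)F(x)|/|x′ − x|^α ≤ ‖ζ‖_α·S + |ζ|·H` (the three cases: both sites in `B(y)` — `ζ′F′ − ζF = ζ′(F′ − F) + (ζ′ − ζ)F`;
exactly one — the other value of `ζ` vanishes; none — zero). [cite: Balaban1984PropagatorsII, Prop. 2.2 (2.67) p.234
(«(‖ζ‖_α + |ζ|)»), dictionary] -/
theorem holder_pair_bound (α : ℝ) (ζ F : ↥(i.XB) → ℝ) (y : ↥(bset i.dom)) (hζ : ∀ w, ζ w ≠ 0 → i.blkD w = y)
    (x x' : ↥(i.XB)) (hne : x ≠ x') {S H : ℝ} (hS0 : 0 ≤ S) (hH0 : 0 ≤ H)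
    (hSx : i.blkD x = y → |F x| ≤ S) (hSx' : i.blkD x' = y → |F x'| ≤ S)
    (hH : i.blkD x = y → i.blkD x' = y → |F x' - F x| / (supNorm (x'.1 - x.1) / i.n) ^ α ≤ H) :
    |ζ x' * F x' - ζ x * F x| / (supNorm (x'.1 - x.1) / i.n) ^ α ≤ i.hq α ζ * S + i.supF ζ * H := by
  have hq0 := i.hq_nonneg α ζ
  have hz0 := i.supF_nonneg ζ
  have hr : 0 < (supNorm (x'.1 - x.1) / i.n) ^ α := by
    have hne' : x'.1 ≠ x.1 := fun h => hne (Subtype.ext h).symm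
    have hs : 0 < supNorm (x'.1 - x.1) := lt_of_lt_of_le one_pos (one_le_supNorm_sub hne')
    have hn : (0 : ℝ) < ((i.n : ℕ) : ℝ) := by exact_mod_cast lt_of_lt_of_le Nat.one_pos i.one_le_n
    exact Real.rpow_pos_of_pos (div_pos hs hn) α
  have hpair : |ζ x' - ζ x| / (supNorm (x'.1 - x.1) / i.n) ^ α ≤ i.hq α ζ := i.pair_le_hq α ζ x x' hne
  by_cases hx : i.blkD x = y
  · by_cases hx' : i.blkD x' = y
    · -- both in `B(y)`
      have e : ζ x' * F x' - ζ x * F x = ζ x' * (F x' - F x) + (ζ x' - ζ x) * F x := by ring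
      rw [e]
      calc |ζ x' * (F x' - F x) + (ζ x' - ζ x) * F x| / (supNorm (x'.1 - x.1) / i.n) ^ α
          ≤ (|ζ x'| * |F x' - F x| + |ζ x' - ζ x| * |F x|) / (supNorm (x'.1 - x.1) / i.n) ^ α := by
            refine div_le_div_of_nonneg_right ?_ hr.le
            calc _ ≤ |ζ x' * (F x' - F x)| + |(ζ x' - ζ x) * F x| := abs_add_le _ _
              _ = _ := by rw [abs_mul, abs_mul]
        _ = |ζ x'| * (|F x' - F x| / (supNorm (x'.1 - x.1) / i.n) ^ α)
            + |ζ x' - ζ x| / (supNorm (x'.1 - x.1) / i.n) ^ α * |F x| := by ring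
        _ ≤ i.supF ζ * H + i.hq α ζ * S := by
            refine add_le_add ?_ ?_
            · exact mul_le_mul (i.abs_le_supF ζ x') (hH hx hx') (by positivity) hz0
            · exact mul_le_mul hpair (hSx hx) (abs_nonneg _) hq0
        _ = i.hq α ζ * S + i.supF ζ * H := by ring
    · -- `x ∈ B(y)`, `x′ ∉ B(y)`: `ζ x′ = 0`
      have hz' : ζ x' = 0 := by by_contra h; exact hx' (hζ x' h)
      rw [hz', zero_mul, zero_sub, abs_neg, abs_mul]
      calc |ζ x| * |F x| / (supNorm (x'.1 - x.1) / i.n) ^ α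
          = |ζ x' - ζ x| / (supNorm (x'.1 - x.1) / i.n) ^ α * |F x| := by rw [hz', zero_sub, abs_neg]; ring
        _ ≤ i.hq α ζ * S := mul_le_mul hpair (hSx hx) (abs_nonneg _) hq0
        _ ≤ i.hq α ζ * S + i.supF ζ * H := le_add_of_nonneg_right (by positivity)
  · -- `x ∉ B(y)`: `ζ x = 0`
    have hz : ζ x = 0 := by by_contra h; exact hx (hζ x h)
    by_cases hx' : i.blkD x' = y
    · rw [hz, zero_mul, sub_zero, abs_mul]
      calc |ζ x'| * |F x'| / (supNorm (x'.1 - x.1) / i.n) ^ α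
          = |ζ x' - ζ x| / (supNorm (x'.1 - x.1) / i.n) ^ α * |F x'| := by rw [hz, sub_zero]; ring
        _ ≤ i.hq α ζ * S := mul_le_mul hpair (hSx' hx') (abs_nonneg _) hq0
        _ ≤ i.hq α ζ * S + i.supF ζ * H := le_add_of_nonneg_right (by positivity)
    · have hz' : ζ x' = 0 := by by_contra h; exact hx' (hζ x' h)
      rw [hz, hz', zero_mul, zero_mul, sub_zero, abs_zero, zero_div]
      positivity

end TLIdx

open TLIdx in
/-- **PROPOSITION 2.2 (2.67), THE HÖLDER ENTRIES 4 AND 5, IN THE CENSUS TYPING ON THE GENUINELY TWO-LEVEL FAMILY, FOR EACH `α`** —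
the second conjunct of `B6.Prop22Printed geo gp` AT A FIXED `0 ≤ α < 1` (quantifier order `∀ α ∃ M₁ δ₀ C`; the census order
`∃ M₁ δ₀ ∃ Cα ∀ α` needs an `α`-uniform rate, see the module docstring): there are `M₁, δ₀, C > 0` (depending on `d`, `L`, `α`)
such that for every member with `M ≥ M₁`, every `λ` with `supp λ ⊂ B(y′)`, every cut-off `ζ` with `supp ζ ⊂ B(y)`:
`max_μ max(‖ζ∇^ξ_μG′λ‖_α, ‖ζG′∇^{ξ*}_μλ‖_α) ≤ C·(L^jη)^{1−α}·(‖ζ‖_α + |ζ|)·e^{−½δ₀d(y,y′)}·|λ|`.  From p21's package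
`prop22_six_twoLevelBox` at this `α` (entries 2, 3 in weighted-row form for the sup of `F`, entries 4, 5 in two-centre weighted
form for the Hölder quotient of `F`), the conversions `abs_sum_mul_le`/`abs_sum_mul_le2` and the product rule `holder_pair_bound`.
[cite: Balaban1984PropagatorsII, Prop. 2.2 (2.67) p.234 (entries 4, 5); (2.46) p.231; p.232] -/
theorem prop22_holderEntries_twoLevel (d ℓ : ℕ) (hℓ : 1 ≤ ℓ) (α : ℝ) (hα0 : 0 ≤ α) (hα1 : α < 1) :
    ∃ M₁ δ₀ C : ℝ, 0 < M₁ ∧ 0 < δ₀ ∧ 0 < C ∧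
      ∀ i : TLIdx d ℓ, i.geo.Hyp21_22 → M₁ ≤ i.geo.M →
        ∀ (lam : i.geo.Loc) (ζ : i.geo.Cut) (y y' : i.geo.Site), i.geo.cutIn ζ y → i.geo.suppIn lam y' →
          i.gp.h1 lam α ζ ≤ C * (i.geo.len y) ^ (1 - α) * i.geo.cutH α ζ *
            Real.exp (-(δ₀ / 2 * i.geo.dist y y')) * i.geo.supNorm lam := by
  classical
  set amin : ℝ := 1 - ((((ℓ : ℝ) + 1)) ^ 2)⁻¹ with hamin_def
  have hL2 : (1 : ℝ) < (((ℓ : ℝ) + 1)) ^ 2 := by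
    have : (2 : ℝ) ≤ (ℓ : ℝ) + 1 := by
      have : (1 : ℝ) ≤ ℓ := by exact_mod_cast hℓ
      linarith
    nlinarith
  have hamin : 0 < amin := by
    rw [hamin_def, sub_pos]
    exact inv_lt_one_of_one_lt₀ hL2
  obtain ⟨δA, M0, CA, hδA, hM0, hCA, hAll⟩ :=
    prop22_six_twoLevelBox d ℓ hℓ amin 1 0 1 1 hamin one_pos α hα0 hα1
  refine ⟨max M0 (3 * ((ℓ : ℝ) + 1)), 2 * (δA / (d + 1)), CA * Real.exp δA, lt_max_of_lt_left hM0, by positivity,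
    by positivity, ?_⟩
  intro i _ hM lam ζ y y' hcut hsupp
  change ↥(i.XB) → ℝ at lam
  change ↥(i.XB) → ℝ at ζ
  rw [geo_M] at hM
  have hM0' : M0 ≤ ((ℓ : ℝ) + 1) * i.Mh := le_trans (le_max_left _ _) hM
  have hMh3 : 3 ≤ i.Mh := by
    have h3 : 3 * ((ℓ : ℝ) + 1) ≤ ((ℓ : ℝ) + 1) * i.Mh := le_trans (le_max_right _ _) hM
    have hL : (0 : ℝ) < (ℓ : ℝ) + 1 := by positivity
    have : (3 : ℝ) ≤ i.Mh := by nlinarith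
    exact_mod_cast this
  obtain ⟨haj1, haj2, _⟩ := aPrinted_window hℓ one_pos i.hk
  rw [one_mul] at haj1
  obtain ⟨-, h2, h3, h4, h5, -⟩ := hAll i.k i.hk (aPrinted ℓ 1 i.k) 0 1 haj1 haj2 le_rfl le_rfl le_rfl le_rfl i.Mh hMh3
    hM0' (fun μ => (ℓ + 1) * i.P μ)
    (fun μ => Nat.one_le_iff_ne_zero.2 (Nat.mul_ne_zero_iff.2 ⟨by omega, by have := i.hP μ; omega⟩)) i.LamU i.isBlockUnion_LamU
  -- read them on the member's operator `i.G`
  have h2' : ∀ (μ : Fin (d + 1)) (x xe : ↥(i.XB)), xe.1 = x.1 + Pi.single μ 1 →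
      wsum δA i.n x (fun z => ((i.n : ℕ) : ℝ) * (i.G xe z - i.G x z)) ≤ CA := h2
  have h3' : ∀ (μ : Fin (d + 1)) (x : ↥(i.XB)), roww δA i.n (dstar i.n μ i.G) x ≤ CA := h3
  have h4' : ∀ (μ : Fin (d + 1)) (x xe x' xe' : ↥(i.XB)), xe.1 = x.1 + Pi.single μ 1 → xe'.1 = x'.1 + Pi.single μ 1 →
      x'.1 ≠ x.1 → wsum2 δA i.n x x' (fun z => (((i.n : ℕ) : ℝ) / supNorm (x'.1 - x.1)) ^ α
        * (((i.n : ℕ) : ℝ) * ((i.G xe' z - i.G x' z) - (i.G xe z - i.G x z)))) ≤ CA := h4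
  have h5' : ∀ (μ : Fin (d + 1)) (x x' : ↥(i.XB)), x'.1 ≠ x.1 →
      wsum2 δA i.n x x' (fun z => (((i.n : ℕ) : ℝ) / supNorm (x'.1 - x.1)) ^ α
        * (dstar i.n μ i.G x' z - dstar i.n μ i.G x z)) ≤ CA := h5
  -- common shape of the target
  have hδ2 : 2 * (δA / (d + 1)) / 2 = δA / (d + 1) := by ring
  rw [hδ2, geo_supNorm]
  rw [geo_suppIn] at hsupp
  change ∀ w, ζ w ≠ 0 → i.blkD w = y at hcut
  change i.hH lam α ζ ≤ CA * Real.exp δA * (i.geo.len y) ^ (1 - α) * (i.hq α ζ + i.supF ζ) *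
    Real.exp (-(δA / (d + 1) * i.geo.dist y y')) * i.supF lam
  set E : ℝ := Real.exp (-(δA / (d + 1) * i.geo.dist y y')) with hE
  have hE0 : 0 ≤ E := (Real.exp_pos _).le
  have hS0 := i.supF_nonneg lam
  have hq0 := i.hq_nonneg α ζ
  have hz0 := i.supF_nonneg ζ
  have hpref : 1 ≤ (i.geo.len y) ^ (1 - α) := Real.one_le_rpow (i.one_le_len y) (by linarith)
  -- the generic value bound `B` (sup AND Hölder quotient of `F`) and the final comparison
  set B : ℝ := CA * Real.exp δA * E * i.supF lam with hB
  have hB0 : 0 ≤ B := by positivity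
  have hfin : (i.hq α ζ + i.supF ζ) * B
      ≤ CA * Real.exp δA * (i.geo.len y) ^ (1 - α) * (i.hq α ζ + i.supF ζ) * E * i.supF lam := by
    have : (i.hq α ζ + i.supF ζ) * B * 1 ≤ (i.hq α ζ + i.supF ζ) * B * (i.geo.len y) ^ (1 - α) :=
      mul_le_mul_of_nonneg_left hpref (by positivity)
    rw [hB] at this ⊢; linarith
  refine le_trans ?_ hfin
  -- one-centre conversion (sup of `F` on `B(y)`) and two-centre conversion (Hölder quotient of `F` inside `B(y)`)
  have conv1 : ∀ (g : ↥(i.XB) → ℝ) (x : ↥(i.XB)), i.blkD x = y → wsum δA i.n x g ≤ CA →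
      |∑ z, g z * lam z| ≤ B := by
    intro g x hx hg
    have h := i.abs_sum_mul_le hδA.le g lam x y' hsupp
    rw [hx] at h
    refine h.trans ?_
    have : Real.exp δA * E * wsum δA i.n x g * i.supF lam ≤ Real.exp δA * E * CA * i.supF lam :=
      mul_le_mul_of_nonneg_right (mul_le_mul_of_nonneg_left hg (by positivity)) hS0
    rw [hB]; linarith
  have conv2 : ∀ (g : ↥(i.XB) → ℝ) (x x' : ↥(i.XB)), i.blkD x = y → i.blkD x' = y → wsum2 δA i.n x x' g ≤ CA →
      |∑ z, g z * lam z| ≤ B := by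
    intro g x x' hx hx' hg
    have h := i.abs_sum_mul_le2 hδA.le g lam x x' y y' hx hx' hsupp
    refine h.trans ?_
    have : Real.exp δA * E * wsum2 δA i.n x x' g * i.supF lam ≤ Real.exp δA * E * CA * i.supF lam :=
      mul_le_mul_of_nonneg_right (mul_le_mul_of_nonneg_left hg (by positivity)) hS0
    rw [hB]; linarith
  have hbound : i.hq α ζ * B + i.supF ζ * B = (i.hq α ζ + i.supF ζ) * B := by ring
  rw [← hbound]
  have hBB : 0 ≤ i.hq α ζ * B + i.supF ζ * B := by positivity
  refine i.hH_le_of_forall lam α ζ (fun μ => ?_) (fun μ => ?_)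
  · -- entry 4: `ζ·∇^ξ_μG′λ`, bond pairs
    refine i.hqB_le_of_forall μ α _ hBB fun x x' hne hxm hxm' => ?_
    have hfx : (fwd i.NB μ x).1 = x.1 + Pi.single μ 1 := B4Lemma22ZeroBoxDerivDual.fwd_val_of_mem μ x hxm
    have hfx' : (fwd i.NB μ x').1 = x'.1 + Pi.single μ 1 := B4Lemma22ZeroBoxDerivDual.fwd_val_of_mem μ x' hxm'
    refine i.holder_pair_bound α ζ (fun w => ((i.n : ℕ) : ℝ) * ((i.G *ᵥ lam) (fwd i.NB μ w) - (i.G *ᵥ lam) w)) y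
      hcut x x' hne hB0 hB0 ?_ ?_ ?_
    · intro hx
      show |((i.n : ℕ) : ℝ) * ((i.G *ᵥ lam) (fwd i.NB μ x) - (i.G *ᵥ lam) x)| ≤ B
      rw [mulVec_sub_eq_sum]; exact conv1 _ x hx (h2' μ x _ hfx)
    · intro hx'
      show |((i.n : ℕ) : ℝ) * ((i.G *ᵥ lam) (fwd i.NB μ x') - (i.G *ᵥ lam) x')| ≤ B
      rw [mulVec_sub_eq_sum]; exact conv1 _ x' hx' (h2' μ x' _ hfx')
    · intro hx hx'
      have hne' : x'.1 ≠ x.1 := fun h => hne (Subtype.ext h).symm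
      show |((i.n : ℕ) : ℝ) * ((i.G *ᵥ lam) (fwd i.NB μ x') - (i.G *ᵥ lam) x')
          - ((i.n : ℕ) : ℝ) * ((i.G *ᵥ lam) (fwd i.NB μ x) - (i.G *ᵥ lam) x)| / (supNorm (x'.1 - x.1) / i.n) ^ α ≤ B
      rw [i.quot_eq_abs_weight α x x' hne', mulVec_sub_eq_sum, mulVec_sub_eq_sum, i.mul_sub_sum]
      refine conv2 _ x x' hx hx' ((le_of_eq ?_).trans (h4' μ x _ x' _ hfx hfx' hne'))
      exact congrArg (wsum2 δA i.n x x') (funext fun z => by ring)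
  · -- entry 5: `ζ·G′∇^{ξ*}_μλ`, site pairs
    refine i.hq_le_of_forall α _ hBB fun x x' hne => ?_
    refine i.holder_pair_bound α ζ (fun w => (dstar i.n μ i.G *ᵥ lam) w) y hcut x x' hne hB0 hB0 ?_ ?_ ?_
    · intro hx
      show |(dstar i.n μ i.G *ᵥ lam) x| ≤ B
      rw [mulVec_eq_sum]; exact conv1 _ x hx (by rw [← roww_eq_wsum]; exact h3' μ x)
    · intro hx'
      show |(dstar i.n μ i.G *ᵥ lam) x'| ≤ B
      rw [mulVec_eq_sum]; exact conv1 _ x' hx' (by rw [← roww_eq_wsum]; exact h3' μ x')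
    · intro hx hx'
      have hne' : x'.1 ≠ x.1 := fun h => hne (Subtype.ext h).symm
      show |(dstar i.n μ i.G *ᵥ lam) x' - (dstar i.n μ i.G *ᵥ lam) x| / (supNorm (x'.1 - x.1) / i.n) ^ α ≤ B
      rw [i.quot_eq_abs_weight α x x' hne', mulVec_eq_sum, mulVec_eq_sum, i.mul_sub_sum]
      exact conv2 _ x x' hx hx' (h5' μ x x' hne')

end Literature.MathematicalPhysics.QuantumFieldTheory.Balaban1983to89.B6Prop22TwoLevelCensus
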